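/-
Copyright (c) 2026 the pub-hodgecm-mathlib formalisation cell (harness21).  Prover seat hodgecm-mathlib-K2E4-p08 (g0),
Track B «K2-LIT» ∕ h413, line `K2_E4_SingularTransferKappaSign`, dealer pool H1 «SingularPairEigenplane» — SEQUEL (the submodule picture).
2026-09-03.
-/
import Summits.HodgeConjecture.HodgeConjecture.Theorems.K2E4SingularPairEigenplane   -- ★ p854875: `exists_pinned_diagonal_frame`, §1 kernel transport
import HarnessLib

/-!
# K2_E4 road (h413 = stmt-HodgeConjecture-24833), pool H1 sequel: the SUBMODULE picture of the semiregular pair —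
# `L³ = W₂ ⊕ W₁`, `dim W₂ = 2`, `dim W₁ = 1`, `W₂ ⊥ W₁`, `H|W₂` non-degenerate, `σ(e₁)e₁ = σ(e₂)e₂ = 1`

Cell `pub/hodgecm-mathlib` (D-0151), Track B, line `Summits/HodgeConjecture/HodgeConjecture/Cruxes/H413/Lines/K2_E4_SingularTransferKappaSign.lean`;
helper file (`--supports stmt-HodgeConjecture-24833`, no socket closed): the dealer's literal H1 items (DEALS `K2/K2E4-plan/g0/DEALS.K2E4-g0.md`:
«`W₂ := ker(γ₀−e₁)` has `finrank = 2`, `W₁ := ker(γ₀−e₂)` has `finrank = 1`, `V = W₂ ⊕ W₁`, `W₂ ⊥ W₁` for `hermForm σ H′`, both non-degenerate;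
`e₁·σ e₁ = 1 = e₂·σ e₂`»), for a field `K` with an involution `σ` (`1 + 1 ≠ 0`), `H ∈ M₃(K)` hermitian with `det H ≠ 0` and a SEMIREGULAR
`γ ∈ U_σ(H)(K)`: `(γ − e₁)(γ − e₂) = 0`, `e₁ ≠ e₂`, `charpoly γ = (X − e₁)²(X − e₂)` — the sockets' binders.  Everything is read off the
pinned diagonal frame of ★ `K2E4SingularPairEigenplane.exists_pinned_diagonal_frame` (`γ P = P·diag(e₁, e₁, e₂)`, `ᵗ(σP) H P = diag(d)`)
[Rogawski1990, §3.8 Prop. 3.8.1 (a) p. 30: the centraliser of a singular semisimple `γ` is `U(W₂) × U(W₁)`, the eigenplane and eigenline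
being `H`-orthogonal non-degenerate hermitian spaces].

* `mem_ker_toLin'_sub_smul_one_iff`, `sub_smul_one_mul_comm`; **`isCompl_ker_sub_smul_one`** (`K³ = W₂ ⊕ W₁`, from `(γ − e₁)(γ − e₂) = 0` alone);
* `conj_mul_self_fst_eq_one`, `conj_mul_self_snd_eq_one` (`σ(e₁)e₁ = σ(e₂)e₂ = 1`);
* **`finrank_ker_sub_smul_one_fst = 2`**, **`finrank_ker_sub_smul_one_snd = 1`** (`W₂ = P·{z | z₂ = 0}`);
* **`hermForm_eq_zero_of_mulVec_sub_smul_one_eq_zero`** (`W₂ ⊥ W₁`) and its mirror `…'`;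
* **`eq_zero_of_forall_hermForm_eq_zero`** (`H|W₂` non-degenerate: an `e₁`-eigenvector orthogonal to `W₂` is orthogonal to `K³`, so `H u = 0`).

HONEST LABEL: HC_CM is proved only modulo the 7 printed citations (2 remaining named inputs: hLiu418 = stmt-HodgeConjecture-24832, h413 =
stmt-HodgeConjecture-24833) until rung 0 closes; this `--supports` helper retires nothing by itself.

## References
* [Rogawski1990] J. D. Rogawski, *Automorphic Representations of Unitary Groups in Three Variables*, Ann. of Math. Stud. 123 (1990), §3.8
  Prop. 3.8.1 (a) p. 30.
-/

set_option autoImplicit false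

set_option linter.dupNamespace false

noncomputable section

open Matrix Polynomial Module
open Literature.NumberTheory.Rogawski1990 Literature.NumberTheory.Automorphic
open Literature.AlgebraicGeometry.ShimuraVarieties (unitaryGroup mem_unitaryGroup_iff hermForm)
open scoped MatrixGroups

namespace Summit.HodgeConjecture.HodgeConjecture.Cruxes.H413.K2E4SingularPairEigenplane

section Submodules

variable {K : Type*} [Field K] (σ : K →+* K)

/-- Unitarity forces `σ(e₁)·e₁ = 1` for the plane eigenvalue. [cite: Rogawski1990, §3.8 Prop. 3.8.1 (a) p. 30] -/
theorem conj_mul_self_fst_eq_one (hσ : ∀ x, σ (σ x) = x) (h2 : (1 : K) + 1 ≠ 0) {H : Matrix (Fin 3) (Fin 3) K}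
    (hH : (H.map σ)ᵀ = H) (hdet : H.det ≠ 0) (γ : unitaryGroup σ H) {e₁ e₂ : K} (hne : e₁ ≠ e₂)
    (hsplit : (((γ : GL (Fin 3) K) : Matrix (Fin 3) (Fin 3) K) - e₁ • 1) * (((γ : GL (Fin 3) K) : Matrix (Fin 3) (Fin 3) K) - e₂ • 1) = 0)
    (hχ : (((γ : GL (Fin 3) K) : Matrix (Fin 3) (Fin 3) K)).charpoly = (X - C e₁) ^ 2 * (X - C e₂)) : σ e₁ * e₁ = 1 := by
  obtain ⟨-, -, h, -⟩ := exists_pinned_diagonal_frame σ hσ h2 hH hdet γ hne hsplit hχ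
  exact h

/-- Unitarity forces `σ(e₂)·e₂ = 1` for the line eigenvalue. [cite: Rogawski1990, §3.8 Prop. 3.8.1 (a) p. 30] -/
theorem conj_mul_self_snd_eq_one (hσ : ∀ x, σ (σ x) = x) (h2 : (1 : K) + 1 ≠ 0) {H : Matrix (Fin 3) (Fin 3) K}
    (hH : (H.map σ)ᵀ = H) (hdet : H.det ≠ 0) (γ : unitaryGroup σ H) {e₁ e₂ : K} (hne : e₁ ≠ e₂)
    (hsplit : (((γ : GL (Fin 3) K) : Matrix (Fin 3) (Fin 3) K) - e₁ • 1) * (((γ : GL (Fin 3) K) : Matrix (Fin 3) (Fin 3) K) - e₂ • 1) = 0)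
    (hχ : (((γ : GL (Fin 3) K) : Matrix (Fin 3) (Fin 3) K)).charpoly = (X - C e₁) ^ 2 * (X - C e₂)) : σ e₂ * e₂ = 1 := by
  obtain ⟨-, -, -, h, -⟩ := exists_pinned_diagonal_frame σ hσ h2 hH hdet γ hne hsplit hχ
  exact h

omit σ in
/-- `x ∈ ker(M − e) ↔ M x = e x`. [cite: Rogawski1990, §3.8 Prop. 3.8.1 p. 30] -/
theorem mem_ker_toLin'_sub_smul_one_iff (M : Matrix (Fin 3) (Fin 3) K) (e : K) (x : Fin 3 → K) :
    x ∈ LinearMap.ker (Matrix.toLin' (M - e • (1 : Matrix (Fin 3) (Fin 3) K))) ↔ M *ᵥ x = e • x := by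
  rw [LinearMap.mem_ker, Matrix.toLin'_apply, sub_smul_one_mulVec, sub_eq_zero]

omit σ in
/-- `(M − a)(M − b) = (M − b)(M − a)`. [cite: Rogawski1990, §3.8 Prop. 3.8.1 p. 30] -/
theorem sub_smul_one_mul_comm (M : Matrix (Fin 3) (Fin 3) K) (a b : K) :
    (M - a • (1 : Matrix (Fin 3) (Fin 3) K)) * (M - b • (1 : Matrix (Fin 3) (Fin 3) K)) =
      (M - b • (1 : Matrix (Fin 3) (Fin 3) K)) * (M - a • (1 : Matrix (Fin 3) (Fin 3) K)) := by
  simp only [sub_mul, mul_sub, Matrix.smul_mul, Matrix.mul_smul, Matrix.one_mul, Matrix.mul_one, smul_smul, mul_comm a b]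
  abel

omit σ in
/-- **`K³ = W₂ ⊕ W₁`** for `W₂ = ker(M − e₁)`, `W₁ = ker(M − e₂)` when `(M − e₁)(M − e₂) = 0`, `e₁ ≠ e₂` (the spectral projectors
`(e₁ − e₂)⁻¹(M − e₂)`, `(e₂ − e₁)⁻¹(M − e₁)`). [cite: Rogawski1990, §3.8 Prop. 3.8.1 (a) p. 30] -/
theorem isCompl_ker_sub_smul_one {M : Matrix (Fin 3) (Fin 3) K} {e₁ e₂ : K} (hne : e₁ ≠ e₂)
    (hsplit : (M - e₁ • (1 : Matrix (Fin 3) (Fin 3) K)) * (M - e₂ • (1 : Matrix (Fin 3) (Fin 3) K)) = 0) :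
    IsCompl (LinearMap.ker (Matrix.toLin' (M - e₁ • (1 : Matrix (Fin 3) (Fin 3) K))))
      (LinearMap.ker (Matrix.toLin' (M - e₂ • (1 : Matrix (Fin 3) (Fin 3) K)))) := by
  have hsplit' : (M - e₂ • (1 : Matrix (Fin 3) (Fin 3) K)) * (M - e₁ • (1 : Matrix (Fin 3) (Fin 3) K)) = 0 := by
    rw [sub_smul_one_mul_comm, hsplit]
  refine ⟨?_, ?_⟩
  · rw [Submodule.disjoint_def]
    intro x h1 h2
    rw [mem_ker_toLin'_sub_smul_one_iff] at h1 h2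
    have h : (e₁ - e₂) • x = 0 := by rw [sub_smul, ← h1, ← h2, sub_self]
    exact (smul_eq_zero.1 h).resolve_left (sub_ne_zero.2 hne)
  · rw [codisjoint_iff, Submodule.eq_top_iff']
    intro x
    have key : (e₁ - e₂) • x = (M - e₂ • (1 : Matrix (Fin 3) (Fin 3) K)) *ᵥ x - (M - e₁ • (1 : Matrix (Fin 3) (Fin 3) K)) *ᵥ x := by
      rw [sub_smul_one_mulVec, sub_smul_one_mulVec, sub_sub_sub_cancel_left, sub_smul]
    have hx : x = (e₁ - e₂)⁻¹ • ((M - e₂ • (1 : Matrix (Fin 3) (Fin 3) K)) *ᵥ x) +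
        (-(e₁ - e₂)⁻¹) • ((M - e₁ • (1 : Matrix (Fin 3) (Fin 3) K)) *ᵥ x) := by
      rw [neg_smul, ← sub_eq_add_neg, ← smul_sub, ← key, smul_smul, inv_mul_cancel₀ (sub_ne_zero.2 hne), one_smul]
    rw [hx]
    refine Submodule.add_mem_sup (Submodule.smul_mem _ _ ?_) (Submodule.smul_mem _ _ ?_)
    · rw [LinearMap.mem_ker, Matrix.toLin'_apply, Matrix.mulVec_mulVec, hsplit, Matrix.zero_mulVec]
    · rw [LinearMap.mem_ker, Matrix.toLin'_apply, Matrix.mulVec_mulVec, hsplit', Matrix.zero_mulVec]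

/-- **`dim W₂(γ) = 2`**: the `e₁`-eigenspace of a semiregular `γ ∈ U_σ(H)(K)` with `charpoly γ = (X − e₁)²(X − e₂)` is a PLANE (it is
`P·{z | z₂ = 0}` in the pinned frame). [cite: Rogawski1990, §3.8 Prop. 3.8.1 (a) p. 30] -/
theorem finrank_ker_sub_smul_one_fst (hσ : ∀ x, σ (σ x) = x) (h2 : (1 : K) + 1 ≠ 0) {H : Matrix (Fin 3) (Fin 3) K}
    (hH : (H.map σ)ᵀ = H) (hdet : H.det ≠ 0) (γ : unitaryGroup σ H) {e₁ e₂ : K} (hne : e₁ ≠ e₂)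
    (hsplit : (((γ : GL (Fin 3) K) : Matrix (Fin 3) (Fin 3) K) - e₁ • 1) * (((γ : GL (Fin 3) K) : Matrix (Fin 3) (Fin 3) K) - e₂ • 1) = 0)
    (hχ : (((γ : GL (Fin 3) K) : Matrix (Fin 3) (Fin 3) K)).charpoly = (X - C e₁) ^ 2 * (X - C e₂)) :
    finrank K (LinearMap.ker (Matrix.toLin' (((γ : GL (Fin 3) K) : Matrix (Fin 3) (Fin 3) K) - e₁ • (1 : Matrix (Fin 3) (Fin 3) K)))) = 2 := by
  obtain ⟨P, d, -, -, -, -, -, hγP⟩ := exists_pinned_diagonal_frame σ hσ h2 hH hdet γ hne hsplit hχ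
  -- the coordinate plane `{z | z₂ = 0}`
  have hS : finrank K (LinearMap.ker (LinearMap.proj (R := K) (φ := fun _ : Fin 3 => K) (2 : Fin 3))) = 2 := by
    have h := LinearMap.finrank_range_add_finrank_ker (LinearMap.proj (R := K) (φ := fun _ : Fin 3 => K) (2 : Fin 3))
    have hr : finrank K (LinearMap.range (LinearMap.proj (R := K) (φ := fun _ : Fin 3 => K) (2 : Fin 3))) = 1 := by
      rw [LinearMap.range_eq_top.2 (LinearMap.proj_surjective (2 : Fin 3)), finrank_top, Module.finrank_self]
    rw [hr, Module.finrank_fin_fun] at h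
    omega
  -- the frame as a linear equivalence
  let eP : (Fin 3 → K) ≃ₗ[K] (Fin 3 → K) :=
    ((Matrix.GeneralLinearGroup.toLin P : LinearMap.GeneralLinearGroup K (Fin 3 → K)).toLinearEquiv)
  have heP : ∀ z, eP z = (P : Matrix (Fin 3) (Fin 3) K) *ᵥ z := fun z => Matrix.toLin'_apply _ _
  have hW : LinearMap.ker (Matrix.toLin' (((γ : GL (Fin 3) K) : Matrix (Fin 3) (Fin 3) K) - e₁ • (1 : Matrix (Fin 3) (Fin 3) K))) =
      (LinearMap.ker (LinearMap.proj (R := K) (φ := fun _ : Fin 3 => K) (2 : Fin 3))).map (eP : (Fin 3 → K) →ₗ[K] (Fin 3 → K)) := by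
    ext x
    rw [LinearMap.mem_ker, Matrix.toLin'_apply, mulVec_sub_smul_one_eq_zero_iff_of_frame P hγP,
      diagonal_sub_smul_one_mulVec_eq_zero_iff (sub_ne_zero.2 hne.symm).isUnit, Submodule.mem_map]
    constructor
    · intro hx
      refine ⟨((P⁻¹ : GL (Fin 3) K) : Matrix (Fin 3) (Fin 3) K) *ᵥ x, ?_, ?_⟩
      · rw [LinearMap.mem_ker, LinearMap.proj_apply]
        exact hx
      · rw [LinearEquiv.coe_coe, heP, Matrix.mulVec_mulVec, ← Units.val_mul, mul_inv_cancel, Units.val_one, Matrix.one_mulVec]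
    · rintro ⟨z, hz, rfl⟩
      rw [LinearMap.mem_ker, LinearMap.proj_apply] at hz
      rw [LinearEquiv.coe_coe, heP, Matrix.mulVec_mulVec, ← Units.val_mul, inv_mul_cancel, Units.val_one, Matrix.one_mulVec]
      exact hz
  rw [hW, LinearEquiv.finrank_map_eq, hS]

/-- **`dim W₁(γ) = 1`**: the `e₂`-eigenspace is a LINE (complement of the plane). [cite: Rogawski1990, §3.8 Prop. 3.8.1 (a) p. 30] -/
theorem finrank_ker_sub_smul_one_snd (hσ : ∀ x, σ (σ x) = x) (h2 : (1 : K) + 1 ≠ 0) {H : Matrix (Fin 3) (Fin 3) K}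
    (hH : (H.map σ)ᵀ = H) (hdet : H.det ≠ 0) (γ : unitaryGroup σ H) {e₁ e₂ : K} (hne : e₁ ≠ e₂)
    (hsplit : (((γ : GL (Fin 3) K) : Matrix (Fin 3) (Fin 3) K) - e₁ • 1) * (((γ : GL (Fin 3) K) : Matrix (Fin 3) (Fin 3) K) - e₂ • 1) = 0)
    (hχ : (((γ : GL (Fin 3) K) : Matrix (Fin 3) (Fin 3) K)).charpoly = (X - C e₁) ^ 2 * (X - C e₂)) :
    finrank K (LinearMap.ker (Matrix.toLin' (((γ : GL (Fin 3) K) : Matrix (Fin 3) (Fin 3) K) - e₂ • (1 : Matrix (Fin 3) (Fin 3) K)))) = 1 := by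
  have h := Submodule.finrank_add_eq_of_isCompl (isCompl_ker_sub_smul_one hne hsplit)
  rw [finrank_ker_sub_smul_one_fst σ hσ h2 hH hdet γ hne hsplit hχ, Module.finrank_fin_fun] at h
  omega

/-- **`W₂ ⊥ W₁`**: an `e₁`-eigenvector and an `e₂`-eigenvector of `γ ∈ U_σ(H)(K)` are `H`-orthogonal (`⟨γu, γw⟩ = ⟨u, w⟩` gives
`(σ(e₁)e₂ − 1)⟨u, w⟩ = 0`, and `σ(e₁)e₂ ≠ 1 = σ(e₁)e₁`). [cite: Rogawski1990, §3.8 Prop. 3.8.1 (a) p. 30] -/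
theorem hermForm_eq_zero_of_mulVec_sub_smul_one_eq_zero (hσ : ∀ x, σ (σ x) = x) (h2 : (1 : K) + 1 ≠ 0) {H : Matrix (Fin 3) (Fin 3) K}
    (hH : (H.map σ)ᵀ = H) (hdet : H.det ≠ 0) (γ : unitaryGroup σ H) {e₁ e₂ : K} (hne : e₁ ≠ e₂)
    (hsplit : (((γ : GL (Fin 3) K) : Matrix (Fin 3) (Fin 3) K) - e₁ • 1) * (((γ : GL (Fin 3) K) : Matrix (Fin 3) (Fin 3) K) - e₂ • 1) = 0)
    (hχ : (((γ : GL (Fin 3) K) : Matrix (Fin 3) (Fin 3) K)).charpoly = (X - C e₁) ^ 2 * (X - C e₂))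
    {u w : Fin 3 → K} (hu : (((γ : GL (Fin 3) K) : Matrix (Fin 3) (Fin 3) K) - e₁ • (1 : Matrix (Fin 3) (Fin 3) K)) *ᵥ u = 0)
    (hw : (((γ : GL (Fin 3) K) : Matrix (Fin 3) (Fin 3) K) - e₂ • (1 : Matrix (Fin 3) (Fin 3) K)) *ᵥ w = 0) :
    hermForm σ H u w = 0 := by
  have h1 : σ e₁ * e₁ = 1 := conj_mul_self_fst_eq_one σ hσ h2 hH hdet γ hne hsplit hχ
  rw [sub_smul_one_mulVec, sub_eq_zero] at hu hw
  have h := hermForm_mulVec_mulVec σ H γ.2 u w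
  rw [hu, hw, hermForm_smul_left, hermForm_smul_right] at h
  have hne' : σ e₁ * e₂ - 1 ≠ 0 := by
    intro h0
    have hσ0 : σ e₁ ≠ 0 := fun h00 => by rw [h00, zero_mul] at h1; exact zero_ne_one h1
    exact hne (mul_left_cancel₀ hσ0 (h1.trans (sub_eq_zero.1 h0).symm))
  have hmul : (σ e₁ * e₂ - 1) * hermForm σ H u w = 0 := by linear_combination h
  exact (mul_eq_zero.1 hmul).resolve_left hne'

/-- **`W₁ ⊥ W₂`** (the symmetric reading). [cite: Rogawski1990, §3.8 Prop. 3.8.1 (a) p. 30] -/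
theorem hermForm_eq_zero_of_mulVec_sub_smul_one_eq_zero' (hσ : ∀ x, σ (σ x) = x) (h2 : (1 : K) + 1 ≠ 0) {H : Matrix (Fin 3) (Fin 3) K}
    (hH : (H.map σ)ᵀ = H) (hdet : H.det ≠ 0) (γ : unitaryGroup σ H) {e₁ e₂ : K} (hne : e₁ ≠ e₂)
    (hsplit : (((γ : GL (Fin 3) K) : Matrix (Fin 3) (Fin 3) K) - e₁ • 1) * (((γ : GL (Fin 3) K) : Matrix (Fin 3) (Fin 3) K) - e₂ • 1) = 0)
    (hχ : (((γ : GL (Fin 3) K) : Matrix (Fin 3) (Fin 3) K)).charpoly = (X - C e₁) ^ 2 * (X - C e₂))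
    {u w : Fin 3 → K} (hw : (((γ : GL (Fin 3) K) : Matrix (Fin 3) (Fin 3) K) - e₂ • (1 : Matrix (Fin 3) (Fin 3) K)) *ᵥ w = 0)
    (hu : (((γ : GL (Fin 3) K) : Matrix (Fin 3) (Fin 3) K) - e₁ • (1 : Matrix (Fin 3) (Fin 3) K)) *ᵥ u = 0) :
    hermForm σ H w u = 0 := by
  have h1 : σ e₂ * e₂ = 1 := conj_mul_self_snd_eq_one σ hσ h2 hH hdet γ hne hsplit hχ
  rw [sub_smul_one_mulVec, sub_eq_zero] at hu hw
  have h := hermForm_mulVec_mulVec σ H γ.2 w u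
  rw [hu, hw, hermForm_smul_left, hermForm_smul_right] at h
  have hne' : σ e₂ * e₁ - 1 ≠ 0 := by
    intro h0
    have hσ0 : σ e₂ ≠ 0 := fun h00 => by rw [h00, zero_mul] at h1; exact zero_ne_one h1
    exact hne (mul_left_cancel₀ hσ0 ((sub_eq_zero.1 h0).trans h1.symm))
  have hmul : (σ e₂ * e₁ - 1) * hermForm σ H w u = 0 := by linear_combination h
  exact (mul_eq_zero.1 hmul).resolve_left hne'

/-- **`H|W₂` is non-degenerate** (`det H ≠ 0`): an `e₁`-eigenvector `H`-orthogonal to the whole eigenplane `W₂` vanishes — it is then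
orthogonal to `W₂ ⊕ W₁ = K³`, so `H u = 0`. [cite: Rogawski1990, §3.8 Prop. 3.8.1 (a) p. 30] -/
theorem eq_zero_of_forall_hermForm_eq_zero (hσ : ∀ x, σ (σ x) = x) (h2 : (1 : K) + 1 ≠ 0) {H : Matrix (Fin 3) (Fin 3) K}
    (hH : (H.map σ)ᵀ = H) (hdet : H.det ≠ 0) (γ : unitaryGroup σ H) {e₁ e₂ : K} (hne : e₁ ≠ e₂)
    (hsplit : (((γ : GL (Fin 3) K) : Matrix (Fin 3) (Fin 3) K) - e₁ • 1) * (((γ : GL (Fin 3) K) : Matrix (Fin 3) (Fin 3) K) - e₂ • 1) = 0)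
    (hχ : (((γ : GL (Fin 3) K) : Matrix (Fin 3) (Fin 3) K)).charpoly = (X - C e₁) ^ 2 * (X - C e₂))
    {u : Fin 3 → K} (hu : (((γ : GL (Fin 3) K) : Matrix (Fin 3) (Fin 3) K) - e₁ • (1 : Matrix (Fin 3) (Fin 3) K)) *ᵥ u = 0)
    (h : ∀ u' : Fin 3 → K, (((γ : GL (Fin 3) K) : Matrix (Fin 3) (Fin 3) K) - e₁ • (1 : Matrix (Fin 3) (Fin 3) K)) *ᵥ u' = 0 →
      hermForm σ H u' u = 0) : u = 0 := by
  have hcompl := isCompl_ker_sub_smul_one hne hsplit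
  -- every `y` pairs to zero with `u`
  have hall : ∀ y : Fin 3 → K, hermForm σ H y u = 0 := by
    intro y
    have hy : y ∈ LinearMap.ker (Matrix.toLin' (((γ : GL (Fin 3) K) : Matrix (Fin 3) (Fin 3) K) - e₁ • (1 : Matrix (Fin 3) (Fin 3) K))) ⊔
        LinearMap.ker (Matrix.toLin' (((γ : GL (Fin 3) K) : Matrix (Fin 3) (Fin 3) K) - e₂ • (1 : Matrix (Fin 3) (Fin 3) K))) := by
      rw [hcompl.sup_eq_top]; exact Submodule.mem_top
    obtain ⟨y₂, hy₂, y₁, hy₁, rfl⟩ := Submodule.mem_sup.1 hy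
    rw [LinearMap.mem_ker, Matrix.toLin'_apply] at hy₂ hy₁
    rw [hermForm_add_left, h y₂ hy₂, hermForm_eq_zero_of_mulVec_sub_smul_one_eq_zero' σ hσ h2 hH hdet γ hne hsplit hχ hy₁ hu, add_zero]
  -- hence `H u = 0`, and `u = 0`
  have hHu : H *ᵥ u = 0 := by
    funext i
    have hi := hall (Pi.single i 1)
    have hs : ((σ : K → K) ∘ (Pi.single i (1 : K) : Fin 3 → K)) = Pi.single i 1 := by
      funext j
      by_cases hj : j = i
      · subst hj; simp
      · simp [hj]
    rw [hermForm, hs, single_dotProduct, one_mul] at hi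
    exact hi
  exact Matrix.eq_zero_of_mulVec_eq_zero hdet hHu

end Submodules

end Summit.HodgeConjecture.HodgeConjecture.Cruxes.H413.K2E4SingularPairEigenplane

end
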